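import Summits.PneNP.PneNP.Theorems.ChebyshevTracialDesignLevelMarginals
import HarnessLib

/-!
# Cell pnp-psdrank, route `ChebyshevTracialDesign`: a tight psd rectangle has complementary trace densities
# (`τ_X(t) + τ_Y ≤ 1`); a tight-free 0/1 rectangle has `μ + ν ≤ 1`

Tightness (`X_U Y_M = 0` on the pairs with `cc(U,M) = 1`) is the only structure the crux `TracialDecayExp20`
(stmt-PneNP-19878) grants beyond `0 ⪯ X_U, Y_M ⪯ I`. Its zeroth-order ("mode 0") consequence is a DENSITY BUDGET:

* §1 on a tight pair `tr X_U + tr Y_M ≤ r` (`trace_add_trace_le_of_mul_eq_zero`: `0 ≤ tr((I − X)(I − Y)) =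
  r − tr X − tr Y + tr(XY)`);
* §2 averaging over the level class `Q_1(t)`, whose two marginals are uniform (`ChebyshevTracialDesignLevelMarginals`,
  p425886), the normalised trace densities of any tight psd rectangle of any dimension satisfy `τ_X(t) + τ_Y ≤ 1`
  whenever `Q_1(t) ≠ ∅` (`rowDensity_add_colDensity_le_one`); in particular `min(τ_X(t), τ_Y) ≤ 1/2`;
* §3 the `r = 1` / counting form: a rectangle `X × Y` of `t`-cuts and perfect matchings containing no tight pair has
  `|X|/#{t-cuts} + |Y|/#{matchings} ≤ 1` (`density_add_density_le_one_of_tightFree`) — the sets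
  `{(U,M) ∈ Q_1 : U ∈ X}` and `{(U,M) ∈ Q_1 : M ∈ Y}` are disjoint and have sizes `|X|·deg` and `|Y|·deg'`.

This is the `k = 0` term of planner p1's spectral non-tightness expansion (HOME/pnp-psdrank-p1/N2-SpreadStructure.md
§SNT: `0 = μ_1(R) = μν + Σ_{k≥2} γ_k`); the quantitative content of the crux starts at mode `k = 2` ("tight rectangles
have `μν = O(1/n)`", not formalised). WHAT THIS IS NOT: no bound below `1/2` on either density; nothing on psd rank.
Supports crux stmt-PneNP-19878. [cite: Rothvoss2017, §2 (PDF pp. 5–6)] [cite: BrietDadushPokutta2014, Thm. 6 (§3)]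
-/

set_option linter.dupNamespace false -- `Summit.PneNP.PneNP.…`: summit = sub-problem (D-0017)

noncomputable section

namespace Summit.PneNP.PneNP.Theorems.ChebyshevTracialDesignTightDensity

open Finset Matrix Literature.Barriers.PneNP Literature.Combinatorics.Optimization
open Summit.PneNP.PneNP.Theorems.ChebyshevTracialDesignLevelMarginals

variable {n : ℕ}

/-! ### §1 On a tight pair the two traces are complementary -/

/-- **Complementary traces on a tight pair**: if `X, Y ⪯ I` (i.e. `I − X`, `I − Y ⪰ 0`) and `X Y = 0` then
`tr X + tr Y ≤ r`. -/
theorem trace_add_trace_le_of_mul_eq_zero {r : ℕ} {X Y : Matrix (Fin r) (Fin r) ℝ} (hX : (1 - X).PosSemidef)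
    (hY : (1 - Y).PosSemidef) (hXY : X * Y = 0) : X.trace + Y.trace ≤ r := by
  have h : 0 ≤ ((1 - X) * (1 - Y)).trace :=
    (show HasPsdFactorization (fun (_ : Unit) (_ : Unit) => ((1 - X) * (1 - Y)).trace) r from
      ⟨fun _ => 1 - X, fun _ => 1 - Y, fun _ => hX, fun _ => hY, fun _ _ => rfl⟩).nonneg () ()
  have hexp : (1 - X) * (1 - Y) = 1 - X - Y := by
    rw [Matrix.sub_mul, Matrix.one_mul, Matrix.mul_sub, Matrix.mul_one, hXY, sub_zero, sub_right_comm]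
  rw [hexp, trace_sub, trace_sub, trace_one, Fintype.card_fin] at h
  linarith

/-! ### §2 Tight psd rectangles: `τ_X(t) + τ_Y ≤ 1` -/

/-- **Density budget of a tight psd rectangle.** For a psd rectangle `(X, Y)` of dimension `r` (`IsPsdRect`: contractions,
`X_U Y_M = 0` on tight pairs) and a cut size `t` with `Q_1(t) ≠ ∅`, the normalised trace densities
`τ_X(t) = (Σ_{|U|=t} tr X_U)/(r·#{|U|=t})` and `τ_Y = (Σ_M tr Y_M)/(r·#M)` satisfy `τ_X(t) + τ_Y ≤ 1`. -/
theorem rowDensity_add_colDensity_le_one {t r : ℕ} {X : OddSet n → Matrix (Fin r) (Fin r) ℝ}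
    {Y : PMatch n → Matrix (Fin r) (Fin r) ℝ} (h : IsPsdRect X Y) (hQ : (Qset n t 1).Nonempty) :
    (∑ U ∈ univ.filter (fun U : OddSet n => U.1.card = t), (X U).trace) /
        ((r : ℝ) * (univ.filter (fun U : OddSet n => U.1.card = t)).card) +
      (∑ M, (Y M).trace) / ((r : ℝ) * Fintype.card (PMatch n)) ≤ 1 := by
  obtain ⟨q₀, hq₀⟩ := hQ
  rcases Nat.eq_zero_or_pos r with rfl | hr
  · simp
  have ht : q₀.1.1.card = t := (mem_Qset_iff.1 hq₀).1
  set T : Finset (OddSet n) := univ.filter (fun U : OddSet n => U.1.card = t) with hT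
  set ρ : ℕ := (univ.filter fun M : PMatch n => cc q₀.1 M = 1).card with hρ
  set κ : ℕ := (univ.filter fun U : OddSet n => U.1.card = t ∧ cc U q₀.2 = 1).card with hκ
  have hr' : (0 : ℝ) < r := by exact_mod_cast hr
  have hTpos : (0 : ℝ) < T.card := by
    have : q₀.1 ∈ T := by rw [hT, mem_filter]; exact ⟨mem_univ _, ht⟩
    exact_mod_cast card_pos.2 ⟨_, this⟩
  have hPpos : (0 : ℝ) < Fintype.card (PMatch n) := by exact_mod_cast Fintype.card_pos_iff.2 ⟨q₀.2⟩
  have hρpos : (0 : ℝ) < ρ := by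
    have : q₀.2 ∈ univ.filter (fun M : PMatch n => cc q₀.1 M = 1) := by
      rw [mem_filter]; exact ⟨mem_univ _, (mem_Qset_iff.1 hq₀).2⟩
    exact_mod_cast card_pos.2 ⟨_, this⟩
  have hκpos : (0 : ℝ) < κ := by
    have : q₀.1 ∈ univ.filter (fun U : OddSet n => U.1.card = t ∧ cc U q₀.2 = 1) := by
      rw [mem_filter]; exact ⟨mem_univ _, mem_Qset_iff.1 hq₀⟩
    exact_mod_cast card_pos.2 ⟨_, this⟩
  -- the pointwise inequality summed over `Q_1(t)`
  have hsum : ∑ q ∈ Qset n t 1, ((X q.1).trace + (Y q.2).trace) ≤ ∑ _q ∈ Qset n t 1, (r : ℝ) :=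
    sum_le_sum fun q hq => trace_add_trace_le_of_mul_eq_zero (h.1 q.1).2 (h.2.1 q.2).2 (h.2.2 q.1 q.2 (mem_Qset_iff.1 hq).2)
  rw [sum_add_distrib, sum_Qset_fst t 1 (fun U => (X U).trace) q₀.1 ht, sum_Qset_snd t 1 (fun M => (Y M).trace) q₀.2,
    sum_const, nsmul_eq_mul, ← hT, ← hρ, ← hκ] at hsum
  -- `|Q_1(t)| = ρ·#T = κ·#M`
  have hQρ : ((Qset n t 1).card : ℝ) = (ρ : ℝ) * T.card := by
    rw [hρ, hT]; exact card_Qset_eq_rowCount_mul t 1 q₀.1 ht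
  have hQκ : ((Qset n t 1).card : ℝ) = (κ : ℝ) * Fintype.card (PMatch n) := by
    rw [hκ]; exact card_Qset_eq_colCount_mul t 1 q₀.2
  -- divide
  have h1 : (∑ U ∈ T, (X U).trace) / ((r : ℝ) * T.card) = (ρ : ℝ) * (∑ U ∈ T, (X U).trace) / ((r : ℝ) * (Qset n t 1).card) := by
    rw [hQρ, mul_left_comm (r : ℝ), mul_div_mul_left _ _ hρpos.ne']
  have h2 : (∑ M, (Y M).trace) / ((r : ℝ) * Fintype.card (PMatch n)) =
      (κ : ℝ) * (∑ M, (Y M).trace) / ((r : ℝ) * (Qset n t 1).card) := by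
    rw [hQκ, mul_left_comm (r : ℝ), mul_div_mul_left _ _ hκpos.ne']
  have hQpos : (0 : ℝ) < (Qset n t 1).card := by rw [hQρ]; positivity
  rw [h1, h2, ← add_div, div_le_one (by positivity)]
  calc (ρ : ℝ) * ∑ U ∈ T, (X U).trace + (κ : ℝ) * ∑ M, (Y M).trace ≤ ((Qset n t 1).card : ℝ) * r := hsum
    _ = (r : ℝ) * (Qset n t 1).card := mul_comm _ _

/-- In particular one of the two densities of a tight psd rectangle is `≤ 1/2`. -/
theorem min_rowDensity_colDensity_le_half {t r : ℕ} {X : OddSet n → Matrix (Fin r) (Fin r) ℝ}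
    {Y : PMatch n → Matrix (Fin r) (Fin r) ℝ} (h : IsPsdRect X Y) (hQ : (Qset n t 1).Nonempty) :
    min ((∑ U ∈ univ.filter (fun U : OddSet n => U.1.card = t), (X U).trace) /
          ((r : ℝ) * (univ.filter (fun U : OddSet n => U.1.card = t)).card))
        ((∑ M, (Y M).trace) / ((r : ℝ) * Fintype.card (PMatch n))) ≤ 1 / 2 := by
  have h := rowDensity_add_colDensity_le_one (t := t) h hQ
  rcases le_total ((∑ U ∈ univ.filter (fun U : OddSet n => U.1.card = t), (X U).trace) /
          ((r : ℝ) * (univ.filter (fun U : OddSet n => U.1.card = t)).card))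
        ((∑ M, (Y M).trace) / ((r : ℝ) * Fintype.card (PMatch n))) with hle | hle
  · rw [min_eq_left hle]; linarith
  · rw [min_eq_right hle]; linarith

/-! ### §3 Tight-free 0/1 rectangles: `μ + ν ≤ 1` -/

/-- **Density budget of a tight-free rectangle** (the `r = 1`, counting form): if `X` is a family of `t`-cuts, `Y` a
family of perfect matchings, no pair in `X × Y` is tight and `Q_1(t) ≠ ∅`, then `|X|/#{t-cuts} + |Y|/#{matchings} ≤ 1`.
Proof: the pairs of `Q_1(t)` with row in `X` and those with column in `Y` are disjoint, and by the uniform marginals they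
number `|X|·ρ` and `|Y|·κ` with `|Q_1(t)| = ρ·#{t-cuts} = κ·#{matchings}`. -/
theorem density_add_density_le_one_of_tightFree {t : ℕ} (X : Finset (OddSet n)) (Y : Finset (PMatch n))
    (hX : ∀ U ∈ X, U.1.card = t) (hXY : ∀ U ∈ X, ∀ M ∈ Y, cc U M ≠ 1) (hQ : (Qset n t 1).Nonempty) :
    (X.card : ℝ) / (univ.filter (fun U : OddSet n => U.1.card = t)).card +
      (Y.card : ℝ) / Fintype.card (PMatch n) ≤ 1 := by
  classical
  obtain ⟨q₀, hq₀⟩ := hQ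
  have ht : q₀.1.1.card = t := (mem_Qset_iff.1 hq₀).1
  set T : Finset (OddSet n) := univ.filter (fun U : OddSet n => U.1.card = t) with hT
  set ρ : ℕ := (univ.filter fun M : PMatch n => cc q₀.1 M = 1).card with hρ
  set κ : ℕ := (univ.filter fun U : OddSet n => U.1.card = t ∧ cc U q₀.2 = 1).card with hκ
  have hTpos : (0 : ℝ) < T.card := by
    have : q₀.1 ∈ T := by rw [hT, mem_filter]; exact ⟨mem_univ _, ht⟩
    exact_mod_cast card_pos.2 ⟨_, this⟩
  have hPpos : (0 : ℝ) < Fintype.card (PMatch n) := by exact_mod_cast Fintype.card_pos_iff.2 ⟨q₀.2⟩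
  have hρpos : (0 : ℝ) < ρ := by
    have : q₀.2 ∈ univ.filter (fun M : PMatch n => cc q₀.1 M = 1) := by
      rw [mem_filter]; exact ⟨mem_univ _, (mem_Qset_iff.1 hq₀).2⟩
    exact_mod_cast card_pos.2 ⟨_, this⟩
  have hκpos : (0 : ℝ) < κ := by
    have : q₀.1 ∈ univ.filter (fun U : OddSet n => U.1.card = t ∧ cc U q₀.2 = 1) := by
      rw [mem_filter]; exact ⟨mem_univ _, mem_Qset_iff.1 hq₀⟩
    exact_mod_cast card_pos.2 ⟨_, this⟩
  -- indicator sums over `Q_1(t)`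
  have hA : ∑ q ∈ Qset n t 1, (if q.1 ∈ X then (1 : ℝ) else 0) = (ρ : ℝ) * X.card := by
    rw [sum_Qset_fst t 1 (fun U => if U ∈ X then (1 : ℝ) else 0) q₀.1 ht, ← hρ, ← sum_filter]
    congr 1
    have : (univ.filter (fun U : OddSet n => U.1.card = t)).filter (fun U => U ∈ X) = X := by
      ext U
      simp only [mem_filter, mem_univ, true_and]
      exact ⟨fun h => h.2, fun h => ⟨hX U h, h⟩⟩
    rw [this, sum_const, nsmul_eq_mul, mul_one]
  have hB : ∑ q ∈ Qset n t 1, (if q.2 ∈ Y then (1 : ℝ) else 0) = (κ : ℝ) * Y.card := by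
    rw [sum_Qset_snd t 1 (fun M => if M ∈ Y then (1 : ℝ) else 0) q₀.2, ← hκ, ← sum_filter]
    congr 1
    have : (univ : Finset (PMatch n)).filter (fun M => M ∈ Y) = Y := by
      ext M; simp
    rw [this, sum_const, nsmul_eq_mul, mul_one]
  -- disjointness: on `Q_1(t)` the two indicators sum to at most `1`
  have hsum : ∑ q ∈ Qset n t 1, ((if q.1 ∈ X then (1 : ℝ) else 0) + (if q.2 ∈ Y then (1 : ℝ) else 0)) ≤
      ∑ _q ∈ Qset n t 1, (1 : ℝ) := by
    refine sum_le_sum fun q hq => ?_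
    by_cases h1 : q.1 ∈ X
    · by_cases h2 : q.2 ∈ Y
      · exact absurd (mem_Qset_iff.1 hq).2 (hXY q.1 h1 q.2 h2)
      · simp [h1, h2]
    · by_cases h2 : q.2 ∈ Y
      · simp [h1, h2]
      · simp [h1, h2]
  rw [sum_add_distrib, hA, hB, sum_const, nsmul_eq_mul, mul_one] at hsum
  have hQρ : ((Qset n t 1).card : ℝ) = (ρ : ℝ) * T.card := by
    rw [hρ, hT]; exact card_Qset_eq_rowCount_mul t 1 q₀.1 ht
  have hQκ : ((Qset n t 1).card : ℝ) = (κ : ℝ) * Fintype.card (PMatch n) := by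
    rw [hκ]; exact card_Qset_eq_colCount_mul t 1 q₀.2
  have h1 : (X.card : ℝ) / T.card = (ρ : ℝ) * X.card / (Qset n t 1).card := by
    rw [hQρ, mul_div_mul_left _ _ hρpos.ne']
  have h2 : (Y.card : ℝ) / Fintype.card (PMatch n) = (κ : ℝ) * Y.card / (Qset n t 1).card := by
    rw [hQκ, mul_div_mul_left _ _ hκpos.ne']
  have hQpos : (0 : ℝ) < (Qset n t 1).card := by rw [hQρ]; positivity
  rw [h1, h2, ← add_div, div_le_one hQpos]
  exact hsum

end Summit.PneNP.PneNP.Theorems.ChebyshevTracialDesignTightDensity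

end
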